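import Mathlib
import Literature.NumberTheory.Automorphic.GLOneOfHeckeCharacterBJ
import Literature.NumberTheory.Automorphic.ArchExpIdeleGLOne
import Literature.NumberTheory.Automorphic.BookerKrishnamurthyConverse
import Summits.Langlands.Langlands.Theorems.HalfIntegralTwistCM.Negative.ArchParameterGLOne
import Summits.Langlands.Langlands.Theorems.IrreducibilityBySelfDualityRegularTwistCMTwistRealisation

/-!
# Archimedean bookkeeping for the twist of a `GL_N` datum by a Hecke character, and the exponents of
# a Hecke character of a CM-type quadratic extension with finite-order restriction — helper file of
# sub-stub `stub_memberArch` (member statement `pkg_member` of stub `stub_package`, line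
# `one-transparent-pane`, crux `Summit.Langlands.Langlands.Theses.QuadraticWindow.HostInducedRep`,
# item stmt-Langlands-10902)

LOG (wave-3 worker `stub_memberArch`, 2026-08-16).  Fact-free helper lemmas (theorems only; anchor
`memberArchGLOne_anchor`, registered by `stub-add`).  First, over an arbitrary number field `K`:

* `exists_glOne_archParam` — for a Hecke character `θ` of `K`, the `GL₁` datum `π_θ = ℂ·(θ∘det)/⊥`
  (`exists_automorphicRepData_detTwist_glOne`) has Hecke character `θ` and, granted the existence of
  infinity types in rank one, an archimedean parameter `σ ↦ {p σ}` with `p σ - p σ̄ ∈ ℤ`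
  (`archParam_embedding_sub_conj_mem_int_glOne`);
* `exists_infinityType_shift`, `exists_hasInfinityType_twist_glOne` — the infinity type
  `σ ↦ {(a + p σ, b + p σ̄)}` of the twisted datum `π ⊗ (θ ∘ det)` (`hasArchParameter_twist_glOne`);
* `glOne_apply_expIdele_complexPlace`, `normChar_apply_expIdele_complexPlace` — the values of `θ`
  and of `‖·‖^s` on the exponential ideles `γ_K(a_w) = det (exp a_w, 1)` at a complex place `w`:
  `e^{a p(σ_w) + ā p(σ̄_w)}` and `e^{s (a + ā)}`;
* `infiniteIdeleSingle_eq_expIdele` — the idele `(y)_w` supported at a complex place is `γ_K(a_w)`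
  for `ι_w(y) = e^a` (so `(-1)_w = γ_K((iπ)_w)`).

Then, for `K/F₀` quadratic, `w` a complex place of the totally complex `K` over a real place `v` of
`F₀`, the only place over `v` (a hypothesis here), `ψu` a Hecke character of
`K` with `ψu ∘ (𝕀_{F₀} → 𝕀_K) = χ₀` of finite order, `νk = ‖·‖^{k/2}`, and `p` the archimedean
parameter of the `GL₁` datum of `θ = ψu νk`:

* `ideleBaseChange_infiniteIdeleSingle_neg_one_of_unique` — `((-1)_v)_K = (-1)_w`;
* `ideleBaseChange_expIdele_realPlace_of_unique` — `(γ_{F₀}(r·1_v))_K = γ_K(r_w)`;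
* `archParam_complexPlace_of_restrict` — **the exponents of `θ` at `w`**: `p(σ_w) = (k + m_w)/2`,
  `p(σ̄_w) = (k - m_w)/2` for an INTEGER `m_w` with `(-1)^{m_w} = χ₀,v(-1)`.  Proof:
  `θ(γ_K(a_w)) = e^{a p + ā q}` and `νk(γ_K(a_w)) = e^{k(a+ā)/2}`; along `a = r ∈ ℝ` the idele
  `γ_K(r_w)` comes from `F₀`, where `χ₀` has finite order `N`, so `e^{rN(p+q-k)} = 1` for all `r`
  and `p + q = k`; `p - q = m ∈ ℤ` always; and `ψu((-1)_w) = ψu(γ_K((iπ)_w)) = e^{iπ(p-q)} =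
  (-1)^m` is `χ₀((-1)_v)`.  No classification of the characters of `ℂˣ` and no unitarity is used.
[folklore]
-/

open scoped BigOperators Classical ComplexConjugate MatrixGroups Matrix
open NumberField NumberField.InfinitePlace NumberField.mixedEmbedding IsDedekindDomain
open Literature.NumberTheory.Automorphic Literature.NumberTheory.GaloisRepresentations

-- `Summit.Langlands.Langlands.…` (summit = sub-problem name, D-0017 layout) trips `dupNamespace`.
set_option linter.dupNamespace false

noncomputable section

namespace Summit.Langlands.Langlands.Theorems.HostInducedRep.OneTransparentPane

section GLOne

variable {K : Type} [Field K] [NumberField K]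

/-- **The `GL₁` datum of a Hecke character and its archimedean parameter.**  For a Hecke
character `θ` of `K`, the datum `π_θ = ℂ·(θ∘det)/⊥` on `GL₁(𝔸_K)` has Hecke character `θ`
(`r(g) φ - θ(det g) φ ∈ W'`) and — infinity types existing in rank one — an archimedean parameter
`σ ↦ {p σ}` whose exponents at conjugate embeddings differ by integers. [folklore] -/
theorem exists_glOne_archParam
    (hinf : ∀ P : AutomorphicRepData
      (AutomorphyDatum.gl 1 K (isCompact_glFiniteIntegralLevel_holds 1 K)), P.exists_hasInfinityType)
    (θ : HeckeCharacter K) :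
    ∃ (χ₁ : AutomorphicRepData (AutomorphyDatum.gl 1 K (isCompact_glFiniteIntegralLevel_holds 1 K)))
      (p : (K →+* ℂ) → ℂ),
      (∀ (g : (AdelicGroupData.gl 1 K).Adelic), ∀ φ ∈ χ₁.W,
        rightTranslation (AdelicGroupData.gl 1 K) g φ -
          ((θ (Matrix.GeneralLinearGroup.det g) : ℂˣ) : ℂ) • φ ∈ χ₁.W') ∧
      χ₁.HasArchParameter (fun σ ↦ {p σ}) ∧
      ∀ σ : K →+* ℂ, ∃ m : ℤ, p σ - p (ComplexEmbedding.conjugate σ) = m := by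
  obtain ⟨χ₁, hW₁, -⟩ :=
    exists_automorphicRepData_detTwist_glOne (isCompact_glFiniteIntegralLevel_holds 1 K) θ
  have hθ := HalfIntegralTwistCM.Negative.detTwist_datum_heckeCharacter hW₁
  obtain ⟨T₁, hT₁⟩ := hinf χ₁
  set p : (K →+* ℂ) → ℂ := fun σ ↦ ((T₁ σ).map ArchWeight.a).sum with hp_def
  have hpσ : ∀ σ, (T₁ σ).map ArchWeight.a = {p σ} := by
    intro σ
    obtain ⟨x, hx⟩ := Multiset.card_eq_one.mp
      (show Multiset.card ((T₁ σ).map ArchWeight.a) = 1 by rw [Multiset.card_map, hT₁.1.1 σ])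
    rw [hp_def]
    dsimp only
    rw [hx, Multiset.sum_singleton]
  have hp : χ₁.HasArchParameter fun σ ↦ {p σ} := by
    have e : (fun σ ↦ (T₁ σ).map ArchWeight.a) = fun σ ↦ ({p σ} : Multiset ℂ) := funext hpσ
    rw [← e]
    exact hT₁.2
  refine ⟨χ₁, p, hθ, hp, fun σ ↦ ?_⟩
  by_cases hσ : ComplexEmbedding.IsReal σ
  · refine ⟨0, ?_⟩
    rw [ComplexEmbedding.isReal_iff.mp hσ, sub_self, Int.cast_zero]
  · have hw : (InfinitePlace.mk σ).IsComplex := by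
      rw [← not_isReal_iff_isComplex, isReal_mk_iff]
      exact hσ
    obtain ⟨p', q', m, h1, h2, h3⟩ :=
      HalfIntegralTwistCM.Negative.archParam_embedding_sub_conj_mem_int_glOne χ₁ hp ⟨_, hw⟩
    simp only [Multiset.singleton_inj] at h1 h2
    rcases mk_eq_iff.mp (mk_embedding (InfinitePlace.mk σ)) with h | h
    · refine ⟨m, ?_⟩
      rw [h] at h1 h2
      rw [h1, h2, h3]
    · refine ⟨-m, ?_⟩
      have h' : ComplexEmbedding.conjugate σ = (InfinitePlace.mk σ).embedding := by
        have e := congrArg ComplexEmbedding.conjugate h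
        rw [ComplexEmbedding.involutive_conjugate K (InfinitePlace.mk σ).embedding] at e
        exact e.symm
      rw [h] at h2
      rw [h', h1, h2, Int.cast_neg, ← h3]
      ring

omit [NumberField K] in
/-- **Shifting an infinity type by a `GL₁` parameter.**  For a well-formed `T₀` and exponents
`p σ` with `p σ - p σ̄ ∈ ℤ`, the assignment `σ ↦ {(a + p σ, b + p σ̄) : (a, b) ∈ T₀ σ}` is a
well-formed infinity type whose `z`-exponents are those of `T₀` shifted by `p σ`. [folklore] -/
theorem exists_infinityType_shift {N : ℕ} {T₀ : InfinityType K N} (hT₀ : T₀.IsWellFormed)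
    {p : (K →+* ℂ) → ℂ}
    (hp : ∀ σ : K →+* ℂ, ∃ m : ℤ, p σ - p (ComplexEmbedding.conjugate σ) = m) :
    ∃ T : InfinityType K N, T.IsWellFormed ∧
      (∀ σ, (T σ).map ArchWeight.a = ((T₀ σ).map ArchWeight.a).map (· + p σ)) ∧
      ∀ σ, ∀ w ∈ T σ, ∃ w₀ ∈ T₀ σ,
        w.a = w₀.a + p σ ∧ w.b = w₀.b + p (ComplexEmbedding.conjugate σ) := by
  let f : (K →+* ℂ) → ArchWeight → ArchWeight := fun σ w₀ ↦
    ⟨w₀.a + p σ, w₀.b + p (ComplexEmbedding.conjugate σ),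
      w₀.exists_int_sub.elim fun m hm ↦ (hp σ).elim fun m' hm' ↦
        ⟨m + m', by push_cast; rw [← hm, ← hm']; ring⟩⟩
  refine ⟨fun σ ↦ (T₀ σ).map (f σ), ⟨fun σ ↦ ?_, fun σ ↦ ?_⟩, fun σ ↦ ?_, fun σ w hw ↦ ?_⟩
  · change Multiset.card ((T₀ σ).map (f σ)) = N
    rw [Multiset.card_map, hT₀.1 σ]
  · change (T₀ (ComplexEmbedding.conjugate σ)).map (f _) = ((T₀ σ).map (f σ)).map ArchWeight.swap
    rw [hT₀.2 σ, Multiset.map_map, Multiset.map_map]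
    refine Multiset.map_congr rfl fun w₀ _ ↦ ?_
    ext
    · rfl
    · change w₀.a + p (ComplexEmbedding.conjugate (ComplexEmbedding.conjugate σ)) = w₀.a + p σ
      rw [ComplexEmbedding.involutive_conjugate K σ]
  · change ((T₀ σ).map (f σ)).map ArchWeight.a = _
    rw [Multiset.map_map, Multiset.map_map]
    rfl
  · obtain ⟨w₀, hw₀, rfl⟩ := Multiset.mem_map.mp hw
    exact ⟨w₀, hw₀, rfl, rfl⟩

/-- **The infinity type of the twist `π ⊗ (θ ∘ det)` by an arbitrary Hecke character.**  If
`π = W / W'` on `GL_N(𝔸_K)` has infinity type `T₀`, `θ` is the Hecke character of a `GL₁` datum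
`χ₁` with archimedean parameter `σ ↦ {p σ}` (`p σ - p σ̄ ∈ ℤ`), and `π'` is the twisted datum
(`π'.W = (θ∘det)·W`, `π'.W' = (θ∘det)·W'`), then `π'` has an infinity type with `z`-exponents
`{a + p σ}` (`hasArchParameter_twist_glOne`; Borel–Jacquet 1979, 5.7). [folklore] -/
theorem exists_hasInfinityType_twist_glOne {N : ℕ} {hK : isCompact_glFiniteIntegralLevel N K}
    {h1 : isCompact_glFiniteIntegralLevel 1 K} (χ₁ : AutomorphicRepData (AutomorphyDatum.gl 1 K h1))
    {θ : HeckeCharacter K}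
    (hθ : ∀ (g : (AdelicGroupData.gl 1 K).Adelic), ∀ φ ∈ χ₁.W,
      rightTranslation (AdelicGroupData.gl 1 K) g φ -
        ((θ (Matrix.GeneralLinearGroup.det g) : ℂˣ) : ℂ) • φ ∈ χ₁.W')
    {p : (K →+* ℂ) → ℂ} (hp : χ₁.HasArchParameter fun σ ↦ {p σ})
    (hpint : ∀ σ : K →+* ℂ, ∃ m : ℤ, p σ - p (ComplexEmbedding.conjugate σ) = m)
    {π π' : AutomorphicRepData (AutomorphyDatum.gl N K hK)}
    (hW : π'.W = π.W.map (mulChar (detTwist N θ)))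
    (hW' : π'.W' = π.W'.map (mulChar (detTwist N θ)))
    {T₀ : InfinityType K N} (hT₀ : π.HasInfinityType T₀) :
    ∃ T : InfinityType K N, π'.HasInfinityType T ∧
      (∀ σ, (T σ).map ArchWeight.a = ((T₀ σ).map ArchWeight.a).map (· + p σ)) ∧
      ∀ σ, ∀ w ∈ T σ, ∃ w₀ ∈ T₀ σ,
        w.a = w₀.a + p σ ∧ w.b = w₀.b + p (ComplexEmbedding.conjugate σ) := by
  obtain ⟨T, hTwf, hTa, hTmem⟩ := exists_infinityType_shift hT₀.1 hpint
  refine ⟨T, ⟨hTwf, ?_⟩, hTa, hTmem⟩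
  have h := RegularTwistCM.AutomorphicRepData.hasArchParameter_twist_glOne χ₁ hθ hp hW hW' hT₀.2
  have e : (fun σ ↦ (T σ).map ArchWeight.a) = fun σ ↦ ((T₀ σ).map ArchWeight.a).map (· + p σ) :=
    funext hTa
  rw [e]
  exact h

/-- **A Hecke character on the exponential ideles at a complex place.**  If `θ` is the Hecke
character of a `GL₁` datum with archimedean parameter `σ ↦ {p σ}`, then for a complex place `w`
and `a ∈ ℂ`, `θ(det (exp a_w, 1)) = e^{a p(σ_w) + ā p(σ̄_w)}` (`archParam_complexPlace_glOne`).
[folklore] -/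
theorem glOne_apply_expIdele_complexPlace {h1 : isCompact_glFiniteIntegralLevel 1 K}
    (χ₁ : AutomorphicRepData (AutomorphyDatum.gl 1 K h1)) {θ : HeckeCharacter K}
    (hθ : ∀ (g : (AdelicGroupData.gl 1 K).Adelic), ∀ φ ∈ χ₁.W,
      rightTranslation (AdelicGroupData.gl 1 K) g φ -
        ((θ (Matrix.GeneralLinearGroup.det g) : ℂˣ) : ℂ) • φ ∈ χ₁.W')
    {p : (K →+* ℂ) → ℂ} (hp : χ₁.HasArchParameter fun σ ↦ {p σ})
    (w : {w : InfinitePlace K // w.IsComplex}) (a : ℂ) :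
    ((θ (Matrix.GeneralLinearGroup.det (GLn.ofInfinite 1 K
        (expGL (complexPlaceLie 1 w (a • (1 : Matrix (Fin 1) (Fin 1) ℂ)))))) : ℂˣ) : ℂ) =
      Complex.exp (a * p w.1.embedding + conj a * p (ComplexEmbedding.conjugate w.1.embedding)) := by
  obtain ⟨p', q', h1, h2, h3⟩ :=
    HalfIntegralTwistCM.Negative.archParam_complexPlace_glOne χ₁ hθ hp w
  simp only [Multiset.singleton_inj] at h1 h2
  rw [h3 a, h1, h2]

/-- **A norm character on the exponential ideles at a complex place**: if `χ = ‖·‖^s` then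
`χ(det (exp a_w, 1)) = e^{s (a + ā)}` (`|e^a|_ℂ = e^{2 re a}`). [folklore] -/
theorem normChar_apply_expIdele_complexPlace {χ : HeckeCharacter K} {s : ℂ}
    (hχ : ∀ x : ideleGroup K, ((χ x : ℂˣ) : ℂ) = ((ideleNorm x : ℝ) : ℂ) ^ s)
    (w : {w : InfinitePlace K // w.IsComplex}) (a : ℂ) :
    ((χ (Matrix.GeneralLinearGroup.det (GLn.ofInfinite 1 K
        (expGL (complexPlaceLie 1 w (a • (1 : Matrix (Fin 1) (Fin 1) ℂ)))))) : ℂˣ) : ℂ) =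
      Complex.exp (s * (a + conj a)) := by
  rw [hχ, ideleNorm_det_ofInfinite_expGL_eq, normExponent_complexPlaceLie,
    RegularTwistCM.trace_smul_one_fin_one, Complex.ofReal_exp,
    Complex.cpow_def_of_ne_zero (Complex.exp_ne_zero _),
    Complex.log_exp (by rw [Complex.ofReal_im]; exact neg_lt_zero.2 Real.pi_pos)
      (by rw [Complex.ofReal_im]; exact Real.pi_pos.le)]
  congr 1
  rw [Complex.add_conj]
  push_cast
  ring

/-- **The idele supported at a complex place is an exponential idele**: if `ι_w(y) = e^a` then
`(y)_w = det (exp a_w, 1)` (both are `e^a` at `w` and `1` elsewhere). [folklore] -/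
theorem infiniteIdeleSingle_eq_expIdele (w : {w : InfinitePlace K // w.IsComplex})
    (y : (w.1.Completion)ˣ) (a : ℂ)
    (hy : Completion.extensionEmbedding w.1 (y : w.1.Completion) = Complex.exp a) :
    infiniteIdeleSingle w.1 y = Matrix.GeneralLinearGroup.det (GLn.ofInfinite 1 K
        (expGL (complexPlaceLie 1 w (a • (1 : Matrix (Fin 1) (Fin 1) ℂ))))) := by
  refine idele_eq_of_snd_eq_of_extensionEmbedding_eq K ?_ fun w' ↦ ?_
  · rw [det_ofInfinite_snd, infiniteIdeleSingle_snd]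
  · rw [extensionEmbedding_det_ofInfinite_expGL_complexPlaceLie]
    by_cases h : w' = w.1
    · subst h
      rw [if_pos rfl, infiniteIdeleSingle_fst_self, hy]
    · rw [if_neg h, infiniteIdeleSingle_fst_of_ne _ h, map_one]

/-- The idele `(-1)_w` at a complex place `w` is the exponential idele `det (exp (iπ)_w, 1)`.
[folklore] -/
theorem infiniteIdeleSingle_neg_one_eq_expIdele (w : {w : InfinitePlace K // w.IsComplex}) :
    infiniteIdeleSingle w.1 (-1) = Matrix.GeneralLinearGroup.det (GLn.ofInfinite 1 K
        (expGL (complexPlaceLie 1 w (((Real.pi : ℂ) * Complex.I) • (1 : Matrix (Fin 1) (Fin 1) ℂ))))) :=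
  infiniteIdeleSingle_eq_expIdele w (-1) _
    (by rw [Units.val_neg, Units.val_one, map_neg, map_one, Complex.exp_pi_mul_I])

end GLOne

section Restrict

variable {F₀ K : Type} [Field F₀] [NumberField F₀] [Field K] [NumberField K] [Algebra F₀ K]

/-- **Base change of the idele `(-1)_v`** to the unique place `w` over `v`:
`((-1)_v)_K = (-1)_w`. [folklore] -/
theorem ideleBaseChange_infiniteIdeleSingle_neg_one_of_unique {w : InfinitePlace K}
    (huniq : ∀ w' : InfinitePlace K,
      w'.comap (algebraMap F₀ K) = w.comap (algebraMap F₀ K) → w' = w) :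
    AdeleRing.ideleBaseChange F₀ K (infiniteIdeleSingle (w.comap (algebraMap F₀ K)) (-1)) =
      infiniteIdeleSingle w (-1) := by
  refine idele_eq_of_snd_eq_of_extensionEmbedding_eq K ?_ fun w' ↦ ?_
  · rw [AdeleRing.coe_ideleBaseChange, AdeleRing.baseChange_snd, infiniteIdeleSingle_snd, map_one,
      infiniteIdeleSingle_snd]
  · rw [extensionEmbedding_ideleBaseChange_fst_apply]
    by_cases h : w'.comap (algebraMap F₀ K) = w.comap (algebraMap F₀ K)
    · have hw' : w' = w := huniq w' h
      subst hw'
      simp only [infiniteIdeleSingle_fst_self, Units.val_neg, Units.val_one, map_neg, map_one]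
      split_ifs <;> simp
    · have hne : w' ≠ w := fun e ↦ h (by rw [e])
      simp only [infiniteIdeleSingle_fst_of_ne _ h, infiniteIdeleSingle_fst_of_ne _ hne, map_one]
      split_ifs
      · rfl
      · rfl

/-- **Base change of the exponential idele `γ_{F₀}(r · 1_v)`** at a real place `v` of `F₀` to a
totally complex `K` in which `w` is the only place over `v`: it is `γ_K(r_w)`
(`ideleBaseChange_det_ofInfinite_expGL_realPlace`). [folklore] -/
theorem ideleBaseChange_expIdele_realPlace_of_unique [IsTotallyComplex K]
    (w : {w : InfinitePlace K // w.IsComplex}) (hv : (w.1.comap (algebraMap F₀ K)).IsReal)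
    (huniq : ∀ w' : InfinitePlace K,
      w'.comap (algebraMap F₀ K) = w.1.comap (algebraMap F₀ K) → w' = w.1) (r : ℝ) :
    AdeleRing.ideleBaseChange F₀ K (Matrix.GeneralLinearGroup.det (GLn.ofInfinite 1 F₀
        (expGL (realPlaceLie 1 ⟨w.1.comap (algebraMap F₀ K), hv⟩
          (r • (1 : Matrix (Fin 1) (Fin 1) ℝ)))))) =
      Matrix.GeneralLinearGroup.det (GLn.ofInfinite 1 K
        (expGL (complexPlaceLie 1 w ((r : ℂ) • (1 : Matrix (Fin 1) (Fin 1) ℂ))))) := by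
  have hXY : (((fun w' : {w : InfinitePlace K // w.IsReal} ↦
        if w'.1.comap (algebraMap F₀ K) =
          (⟨w.1.comap (algebraMap F₀ K), hv⟩ : {v : InfinitePlace F₀ // v.IsReal}).1 then r else 0,
      fun w' : {w : InfinitePlace K // w.IsComplex} ↦
        if w'.1.comap (algebraMap F₀ K) =
          (⟨w.1.comap (algebraMap F₀ K), hv⟩ : {v : InfinitePlace F₀ // v.IsReal}).1 then (r : ℂ)
        else 0) : mixedSpace K) • (1 : Matrix (Fin 1) (Fin 1) (mixedSpace K))) =
      complexPlaceLie 1 w ((r : ℂ) • (1 : Matrix (Fin 1) (Fin 1) ℂ)) := by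
    refine Matrix.ext fun i j ↦ ?_
    rw [Subsingleton.elim i 0, Subsingleton.elim j 0, smul_one_matrix_apply,
      complexPlaceLie_smul_one_apply]
    refine Prod.ext (funext fun w' ↦ ?_) (funext fun w' ↦ ?_)
    · exact absurd w'.2 (not_isReal_iff_isComplex.mpr (IsTotallyComplex.isComplex w'.1))
    · dsimp only
      by_cases h : w' = w
      · subst h
        rw [Pi.single_eq_same, if_pos rfl]
      · have h' : w'.1.comap (algebraMap F₀ K) ≠ w.1.comap (algebraMap F₀ K) :=
          fun e ↦ h (Subtype.ext (huniq _ e))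
        rw [Pi.single_eq_of_ne h, if_neg h']
  rw [ideleBaseChange_det_ofInfinite_expGL_realPlace, hXY]

/-- **The exponents at a complex place of a Hecke character of `K` whose restriction to `F₀` has
finite order.**  Let `θ = ψu νk` be the Hecke character of a `GL₁` datum `χ₁` on `GL₁(𝔸_K)` with
archimedean parameter `σ ↦ {p σ}` (`p σ - p σ̄ ∈ ℤ`), where `νk = ‖·‖^{k/2}` and
`ψu ∘ (𝕀_{F₀} → 𝕀_K) = χ₀` has finite order; let `w` be a complex place of the totally complex
`K`, the only place over the real place `v = w|_{F₀}`.  Then for an INTEGER `m`,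
`p(σ_w) = (k + m)/2`, `p(σ̄_w) = (k - m)/2` and `χ₀,v(-1) = (-1)^m`.  (`θ(γ_K(a_w)) =
e^{a p(σ_w) + ā p(σ̄_w)}`, `νk(γ_K(a_w)) = e^{k(a + ā)/2}`; on `a = r ∈ ℝ` the idele comes from `F₀`
where `χ₀^N = 1`, forcing `p(σ_w) + p(σ̄_w) = k`; `ψu((-1)_w) = e^{iπ(p(σ_w) - p(σ̄_w))}`.) [folklore] -/
theorem archParam_complexPlace_of_restrict [IsTotallyComplex K]
    {h1 : isCompact_glFiniteIntegralLevel 1 K} (χ₁ : AutomorphicRepData (AutomorphyDatum.gl 1 K h1))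
    {ψu νk : HeckeCharacter K} {χ₀ : HeckeCharacter F₀} {k : ℤ}
    (hθ : ∀ (g : (AdelicGroupData.gl 1 K).Adelic), ∀ φ ∈ χ₁.W,
      rightTranslation (AdelicGroupData.gl 1 K) g φ -
        (((ψu * νk) (Matrix.GeneralLinearGroup.det g) : ℂˣ) : ℂ) • φ ∈ χ₁.W')
    {p : (K →+* ℂ) → ℂ} (hp : χ₁.HasArchParameter fun σ ↦ {p σ})
    (hpint : ∀ σ : K →+* ℂ, ∃ m : ℤ, p σ - p (ComplexEmbedding.conjugate σ) = m)
    (hres : ∀ x, ψu (AdeleRing.ideleBaseChange F₀ K x) = χ₀ x) (hfin : χ₀.IsFiniteOrder)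
    (hνk : ∀ x : ideleGroup K, ((νk x : ℂˣ) : ℂ) = ((ideleNorm x : ℝ) : ℂ) ^ ((k : ℂ) / 2))
    (w : {w : InfinitePlace K // w.IsComplex}) (hv : (w.1.comap (algebraMap F₀ K)).IsReal)
    (huniq : ∀ w' : InfinitePlace K,
      w'.comap (algebraMap F₀ K) = w.1.comap (algebraMap F₀ K) → w' = w.1) :
    ∃ m : ℤ, p w.1.embedding = ((k : ℂ) + m) / 2 ∧
      p (ComplexEmbedding.conjugate w.1.embedding) = ((k : ℂ) - m) / 2 ∧
      ((χ₀.archComponent (w.1.comap (algebraMap F₀ K)) (-1) : ℂˣ) : ℂ) = (-1 : ℂ) ^ m := by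
  -- the values of `ψu` on the exponential ideles at `w`
  have hψa : ∀ a : ℂ, ((ψu (Matrix.GeneralLinearGroup.det (GLn.ofInfinite 1 K
      (expGL (complexPlaceLie 1 w (a • (1 : Matrix (Fin 1) (Fin 1) ℂ)))))) : ℂˣ) : ℂ) =
      Complex.exp (a * (p w.1.embedding - k / 2) +
        conj a * (p (ComplexEmbedding.conjugate w.1.embedding) - k / 2)) := by
    intro a
    have h := glOne_apply_expIdele_complexPlace χ₁ hθ hp w a
    rw [HeckeCharacter.mul_apply, Units.val_mul, normChar_apply_expIdele_complexPlace hνk w a] at h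
    rw [(eq_mul_inv_iff_mul_eq₀ (Complex.exp_ne_zero _)).mpr h, ← Complex.exp_neg,
      ← Complex.exp_add]
    congr 1
    ring
  -- `p(σ_w) - p(σ̄_w) ∈ ℤ`
  obtain ⟨m, hm⟩ := hpint w.1.embedding
  -- the restriction identity along `r ↦ γ(r)`: `χ₀(γ_{F₀}(r·1_v)) = e^{r (p + q - k)}`
  have hχr : ∀ r : ℝ, ((χ₀ (Matrix.GeneralLinearGroup.det (GLn.ofInfinite 1 F₀
      (expGL (realPlaceLie 1 ⟨w.1.comap (algebraMap F₀ K), hv⟩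
        (r • (1 : Matrix (Fin 1) (Fin 1) ℝ)))))) : ℂˣ) : ℂ) =
      Complex.exp (r * (p w.1.embedding + p (ComplexEmbedding.conjugate w.1.embedding) - k)) := by
    intro r
    rw [← hres, ideleBaseChange_expIdele_realPlace_of_unique w hv huniq r, hψa r,
      Complex.conj_ofReal]
    congr 1
    ring
  -- finite order of `χ₀` forces `p + q = k`
  obtain ⟨N, hN, hχN⟩ := hfin.exists_pow_eq_one
  have hsum : p w.1.embedding + p (ComplexEmbedding.conjugate w.1.embedding) = k := by
    have key : (N : ℂ) *
        (p w.1.embedding + p (ComplexEmbedding.conjugate w.1.embedding) - k) = 0 := by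
      refine eq_of_forall_cexp_mul_eq fun t ↦ ?_
      rw [mul_zero, Complex.exp_zero,
        show (t : ℂ) * ((N : ℂ) *
            (p w.1.embedding + p (ComplexEmbedding.conjugate w.1.embedding) - k)) =
          (N : ℂ) * (t * (p w.1.embedding + p (ComplexEmbedding.conjugate w.1.embedding) - k))
          by ring,
        Complex.exp_nat_mul, ← hχr t, ← Units.val_pow_eq_pow_val, ← HeckeCharacter.pow_apply, hχN,
        HeckeCharacter.one_apply, Units.val_one]
    have hN0 : (N : ℂ) ≠ 0 := Nat.cast_ne_zero.mpr hN.ne'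
    have h0 := (mul_eq_zero.mp key).resolve_left hN0
    linear_combination h0
  -- parity: `χ₀((-1)_v) = ψu((-1)_w) = e^{iπ (p - q)} = (-1)^m`
  have hneg : ((χ₀.archComponent (w.1.comap (algebraMap F₀ K)) (-1) : ℂˣ) : ℂ) = (-1 : ℂ) ^ m := by
    rw [HeckeCharacter.archComponent_apply, ← hres,
      ideleBaseChange_infiniteIdeleSingle_neg_one_of_unique huniq,
      infiniteIdeleSingle_neg_one_eq_expIdele w, hψa, map_mul, Complex.conj_ofReal, Complex.conj_I,
      show (Real.pi : ℂ) * Complex.I * (p w.1.embedding - k / 2) +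
          Real.pi * -Complex.I * (p (ComplexEmbedding.conjugate w.1.embedding) - k / 2) =
        (m : ℂ) * (Real.pi * Complex.I) by rw [← hm]; ring,
      Complex.exp_int_mul, Complex.exp_pi_mul_I]
  refine ⟨m, ?_, ?_, hneg⟩
  · linear_combination (hsum + hm) / 2
  · linear_combination (hsum - hm) / 2

end Restrict

/-- **Registered anchor** of this helper file (stub registry of stmt-Langlands-10902, line
`one-transparent-pane`): the idele `(-1)_w` at a complex place is an exponential idele. [folklore] -/
theorem memberArchGLOne_anchor : ∀ (K : Type) [Field K] [NumberField K] (w : {w : InfinitePlace K // w.IsComplex}), infiniteIdeleSingle w.1 (-1) = Matrix.GeneralLinearGroup.det (GLn.ofInfinite 1 K (expGL (complexPlaceLie 1 w (((Real.pi : ℂ) * Complex.I) • (1 : Matrix (Fin 1) (Fin 1) ℂ))))) :=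
  fun _ _ _ w ↦ infiniteIdeleSingle_neg_one_eq_expIdele w

end Summit.Langlands.Langlands.Theorems.HostInducedRep.OneTransparentPane

end
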